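import Summits.QuantumFields.YangMills.Theorems.UnitScaleGibbsAveragedPlaquetteLawSymmetry
import HarnessLib

/-!
# One plaquette per height WITH THE SMALL-HISTORY CONDITIONER: the Gibbs mass of
# `{θ ≤ dist1(Ū^j(∂a))} ∩ {∀ i < j, PlaqSmall θ_i (Ū^i)}` does not depend on the level-`j` plaquette `a`

Cell `ym3-torus` (YM ladder rung R3 = continuum SU(2) Yang–Mills on the three-torus — NOT d = 4, NOT infinite volume, NOT a mass gap,
NOT the Clay problem), width seat `ym-ust-19936-w3` gen 18; companion of ✓`UnitScaleGibbsAveragedPlaquetteLawSymmetry` (p742675).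
The K2-lane letters of record for the deep heights of the crux `HistoryTailL` (stmt-QuantumFields-19936) — LEAD's K-19
`historyTailL_of_pinnedHeightTail (hP)` / `…_of_geometricHeightTail (hG)` and K-20's weak letter — bound, for EVERY plaquette
`a : Plaq (F.P K) j`, the Gibbs mass of the PINNED event `{θBal(K−j) ≤ dist1(Ū^j(∂a))}` CONDITIONED on the small history below height `j`,
`{∀ i < j, PlaqSmall θBal(K−i) (Ū^i)}`.  This file shows that this conditioned mass is the SAME for all plaquettes `a` of height `j`
(so any supplier — e.g. the Z-level pinned tower of the «pinned (41)» plan — may fix ONE reference plaquette per height):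

* §1 (generic `P : Params`, `β ≥ 0`): for ANY conditioner `B : Set (GaugeField P 0 G)` invariant under the coordinate permutations
  `U ↦ π·U` and under the level-`j` block translations `U ↦ τ_{L^j b} U`, the mass `Gibbs(B ∩ {U | Q(dist1(Ū^j U(∂p)))})` does not depend
  on `p` (`gibbsMeasure_inter_setOf_dist1_iterPlaq_eq`, every predicate `Q`; from §1/§4 of the companion: measure invariance + tower
  covariance + `exists_permute_translate_eq`);
* §2 the small-history conditioner `{U | ∀ i, i < j → PlaqSmall (θ i) (Ū^i U)}` (any thresholds `θ : ℕ → ℝ`) IS such a `B`: permutation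
  invariance by lit ✓`B12RegularClassInvariance263.plaqSmall_permute_iff`, and invariance under level-`j` block translations because a
  level-`j` lattice vector is a level-`i` lattice vector for every `i ≤ j` (`exists_scaleTo_eq`: `Site.scaleTo j b = Site.scaleTo i c`)
  and ✓`plaqSmall_translate_iff` — heights `i > j` are never conditioned on by the letters, and are NOT block-translation invariant;
* §3 the statement in the lane's tokens at `ℰ := ℰp` on `SU(2)` (`gibbsK F ℰp γ K`, the two events written as in K-19 :60–66) and the
  reduction «the letter's inner inequality at ONE reference plaquette `q` ⇒ at every `a` of that height» (`pinnedCondTail_le_of_ref`).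

HONEST: lattice-symmetry bookkeeping; proves NO stub; `hP`, `PlanPinned41.stub_pinnedRatio`, `EntropyFloor.stub_geometricTail`, stmt-24187
and the crux `HistoryTailL` are NOT proved; the Yang–Mills mass gap is NOT proved.
-/

noncomputable section

open MeasureTheory
open Literature.MathematicalPhysics.QuantumFieldTheory.Balaban1983to89
open Literature.MathematicalPhysics.QuantumFieldTheory.Balaban1983to89.T3ContinuumYM3Torus
open Literature.MathematicalPhysics.QuantumFieldTheory.Balaban1983to89.T3UnitScaleTilt
open Literature.MathematicalPhysics.QuantumFieldTheory.Balaban1983to89.T3UnitLawDensityEML (ℰp)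
open Summit.QuantumFields.YangMills.Theorems.UnitScaleGibbsAveragedPlaquetteLawSymmetry

namespace Summit.QuantumFields.YangMills.Theorems.UnitScaleGibbsAveragedPlaquetteLawSymmetryCond

/-! ## §1 A permutation- and block-translation-invariant conditioner does not break the reduction -/

section Generic

variable {P : Params} {G : Type*} [GaugeGroup G] [MeasurableSpace G] [HaarData G] [RegularGaugeGroup G]

/-- Under `π·`: `Gibbs(B ∩ {Q(dist1(Ū^j U(∂(π·p))))}) = Gibbs(B ∩ {Q(dist1(Ū^j U(∂p)))})` for a permutation-invariant `B`. [folklore] -/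
theorem gibbsMeasure_inter_setOf_dist1_iterPlaq_permute {β : ℝ} (hβ : 0 ≤ β) (ℰ : LoopAverage G) {j : ℕ}
    {B : Set (GaugeField P 0 G)} (hBπ : ∀ (π : Equiv.Perm (Fin P.d)) (U : GaugeField P 0 G), U.permute π ∈ B ↔ U ∈ B)
    (π : Equiv.Perm (Fin P.d)) (p : Plaq P j) (Q : ℝ → Prop) :
    T4GenFunBounds.gibbsMeasure (G := G) P β
        (B ∩ {U | Q (dist1 (GaugeField.plaqHol (Averaging.iter (fun i => BlockAveraging.blockAvg (P := P) (j := i) ℰ) j U) (p.permute π)))}) =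
      T4GenFunBounds.gibbsMeasure (G := G) P β
        (B ∩ {U | Q (dist1 (GaugeField.plaqHol (Averaging.iter (fun i => BlockAveraging.blockAvg (P := P) (j := i) ℰ) j U) p))}) := by
  have hset : B ∩ {U | Q (dist1 (GaugeField.plaqHol (Averaging.iter (fun i => BlockAveraging.blockAvg (P := P) (j := i) ℰ) j U)
      (p.permute π)))} = GaugeField.permute π ⁻¹'
        (B ∩ {U | Q (dist1 (GaugeField.plaqHol (Averaging.iter (fun i => BlockAveraging.blockAvg (P := P) (j := i) ℰ) j U) p))}) := by
    ext U
    simp only [Set.mem_inter_iff, Set.mem_setOf_eq, Set.mem_preimage, hBπ, iter_blockAvg_permute,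
      B12RegularClassInvariance263.dist1_plaqHol_permute]
  rw [hset, gibbsMeasure_preimage_permute hβ]

/-- Under `τ_b`: `Gibbs(B ∩ {Q(dist1(Ū^j U(∂(p + b))))}) = Gibbs(B ∩ {Q(dist1(Ū^j U(∂p)))})` for a `B` invariant under the level-`j` block
translations `τ_{L^j b}`. [folklore] -/
theorem gibbsMeasure_inter_setOf_dist1_iterPlaq_translate {β : ℝ} (hβ : 0 ≤ β) (ℰ : LoopAverage G) {j : ℕ}
    {B : Set (GaugeField P 0 G)} (hBτ : ∀ (b : Site P j) (U : GaugeField P 0 G), U.translate (Site.scaleTo j b) ∈ B ↔ U ∈ B)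
    (b : Site P j) (p : Plaq P j) (Q : ℝ → Prop) :
    T4GenFunBounds.gibbsMeasure (G := G) P β
        (B ∩ {U | Q (dist1 (GaugeField.plaqHol (Averaging.iter (fun i => BlockAveraging.blockAvg (P := P) (j := i) ℰ) j U) (p.translate b)))}) =
      T4GenFunBounds.gibbsMeasure (G := G) P β
        (B ∩ {U | Q (dist1 (GaugeField.plaqHol (Averaging.iter (fun i => BlockAveraging.blockAvg (P := P) (j := i) ℰ) j U) p))}) := by
  have hset : B ∩ {U | Q (dist1 (GaugeField.plaqHol (Averaging.iter (fun i => BlockAveraging.blockAvg (P := P) (j := i) ℰ) j U)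
      (p.translate b)))} = GaugeField.translate (Site.scaleTo j b) ⁻¹'
        (B ∩ {U | Q (dist1 (GaugeField.plaqHol (Averaging.iter (fun i => BlockAveraging.blockAvg (P := P) (j := i) ℰ) j U) p))}) := by
    ext U
    simp only [Set.mem_inter_iff, Set.mem_setOf_eq, Set.mem_preimage, hBτ, iter_blockAvg_translate, GaugeField.plaqHol_translate]
  rw [hset, gibbsMeasure_preimage_translate hβ]

/-- **ONE PLAQUETTE PER HEIGHT, CONDITIONED**: for a conditioner `B` invariant under the coordinate permutations and the level-`j` block
translations, any two plaquettes `p q` of level `j` and EVERY predicate `Q`,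
`Gibbs(B ∩ {U | Q(dist1(Ū^j U(∂p)))}) = Gibbs(B ∩ {U | Q(dist1(Ū^j U(∂q)))})`. [folklore] -/
theorem gibbsMeasure_inter_setOf_dist1_iterPlaq_eq {β : ℝ} (hβ : 0 ≤ β) (ℰ : LoopAverage G) {j : ℕ}
    {B : Set (GaugeField P 0 G)} (hBπ : ∀ (π : Equiv.Perm (Fin P.d)) (U : GaugeField P 0 G), U.permute π ∈ B ↔ U ∈ B)
    (hBτ : ∀ (b : Site P j) (U : GaugeField P 0 G), U.translate (Site.scaleTo j b) ∈ B ↔ U ∈ B)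
    (p q : Plaq P j) (Q : ℝ → Prop) :
    T4GenFunBounds.gibbsMeasure (G := G) P β
        (B ∩ {U | Q (dist1 (GaugeField.plaqHol (Averaging.iter (fun i => BlockAveraging.blockAvg (P := P) (j := i) ℰ) j U) p))}) =
      T4GenFunBounds.gibbsMeasure (G := G) P β
        (B ∩ {U | Q (dist1 (GaugeField.plaqHol (Averaging.iter (fun i => BlockAveraging.blockAvg (P := P) (j := i) ℰ) j U) q))}) := by
  obtain ⟨π, b, rfl⟩ := exists_permute_translate_eq p q
  rw [gibbsMeasure_inter_setOf_dist1_iterPlaq_translate hβ ℰ hBτ b, gibbsMeasure_inter_setOf_dist1_iterPlaq_permute hβ ℰ hBπ π p]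

/-- Real-mass form of `gibbsMeasure_inter_setOf_dist1_iterPlaq_eq`. [folklore] -/
theorem gibbsMeasure_real_inter_setOf_dist1_iterPlaq_eq {β : ℝ} (hβ : 0 ≤ β) (ℰ : LoopAverage G) {j : ℕ}
    {B : Set (GaugeField P 0 G)} (hBπ : ∀ (π : Equiv.Perm (Fin P.d)) (U : GaugeField P 0 G), U.permute π ∈ B ↔ U ∈ B)
    (hBτ : ∀ (b : Site P j) (U : GaugeField P 0 G), U.translate (Site.scaleTo j b) ∈ B ↔ U ∈ B)
    (p q : Plaq P j) (Q : ℝ → Prop) :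
    (T4GenFunBounds.gibbsMeasure (G := G) P β).real
        (B ∩ {U | Q (dist1 (GaugeField.plaqHol (Averaging.iter (fun i => BlockAveraging.blockAvg (P := P) (j := i) ℰ) j U) p))}) =
      (T4GenFunBounds.gibbsMeasure (G := G) P β).real
        (B ∩ {U | Q (dist1 (GaugeField.plaqHol (Averaging.iter (fun i => BlockAveraging.blockAvg (P := P) (j := i) ℰ) j U) q))}) := by
  rw [measureReal_def, measureReal_def, gibbsMeasure_inter_setOf_dist1_iterPlaq_eq hβ ℰ hBπ hBτ p q Q]

end Generic

/-! ## §2 The small-history conditioner below height `j` is permutation- and block-translation-invariant -/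

section Conditioner

variable {P : Params} {G : Type*} [GaugeGroup G]

/-- **A level-`j` lattice vector is a level-`i` lattice vector for every `i ≤ j`**: `L^j·b = L^i·c` with `c := L^{j−i}·b`
(`Site.scaleTo (k+1) b = Site.scaleTo k (Site.scale b)` iterated). [cite: Balaban1987RG1, (0.1) p.251] -/
theorem exists_scaleTo_eq {i j : ℕ} (hij : i ≤ j) (b : Site P j) : ∃ c : Site P i, Site.scaleTo j b = Site.scaleTo i c := by
  obtain ⟨k, rfl⟩ := Nat.exists_eq_add_of_le hij
  clear hij
  induction k with
  | zero => exact ⟨b, rfl⟩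
  | succ k ih =>
    obtain ⟨c, hc⟩ := ih (Site.scale b)
    refine ⟨c, ?_⟩
    rw [← hc]
    rfl

/-- **The small-history conditioner is permutation invariant**: `(∀ i < j, PlaqSmall θ_i (Ū^i(π·U))) ↔ (∀ i < j, PlaqSmall θ_i (Ū^i U))`
(any thresholds; also with `i ≤ j` or any set of heights). [cite: Balaban1987RG1, (2.17) p.269] -/
theorem histBelow_permute_iff (ℰ : LoopAverage G) (θ : ℕ → ℝ) (R : ℕ → Prop) (π : Equiv.Perm (Fin P.d)) (U : GaugeField P 0 G) :
    (∀ i, R i → PlaqSmall (θ i) (Averaging.iter (fun i' => BlockAveraging.blockAvg (P := P) (j := i') ℰ) i (U.permute π))) ↔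
      (∀ i, R i → PlaqSmall (θ i) (Averaging.iter (fun i' => BlockAveraging.blockAvg (P := P) (j := i') ℰ) i U)) := by
  simp only [iter_blockAvg_permute, B12RegularClassInvariance263.plaqSmall_permute_iff]

/-- **The small-history conditioner below height `j` is invariant under the level-`j` block translations**:
`(∀ i < j, PlaqSmall θ_i (Ū^i(τ_{L^j b} U))) ↔ (∀ i < j, PlaqSmall θ_i (Ū^i U))` (heights `i ≤ j` also allowed). [cite: Balaban1987RG1, (2.17) p.269] -/
theorem histBelow_translate_iff (ℰ : LoopAverage G) (θ : ℕ → ℝ) {j : ℕ} (R : ℕ → Prop) (hR : ∀ i, R i → i ≤ j) (b : Site P j)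
    (U : GaugeField P 0 G) :
    (∀ i, R i → PlaqSmall (θ i) (Averaging.iter (fun i' => BlockAveraging.blockAvg (P := P) (j := i') ℰ) i
        (U.translate (Site.scaleTo j b)))) ↔
      (∀ i, R i → PlaqSmall (θ i) (Averaging.iter (fun i' => BlockAveraging.blockAvg (P := P) (j := i') ℰ) i U)) := by
  refine forall_congr' fun i => forall_congr' fun hi => ?_
  obtain ⟨c, hc⟩ := exists_scaleTo_eq (P := P) (hR i hi) b
  rw [hc, iter_blockAvg_translate, B12RegularClassInvariance263.plaqSmall_translate_iff]

end Conditioner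

/-! ## §3 In the lane's tokens: the conditioned pinned event of the letters `hP` / `hG` / `hW` -/

section T3

variable (F : T3Family) {G : Type*} [GaugeGroup G] [MeasurableSpace G] [HaarData G] [RegularGaugeGroup G]
  (ℰ : LoopAverage G) {γ : ℝ}

/-- **`gibbsK`, CONDITIONED: ONE PLAQUETTE PER HEIGHT** — for `0 ≤ γ`, thresholds `θ : ℕ → ℝ`, a set of conditioned heights `R` all `≤ j`,
any two plaquettes `p q : Plaq (F.P K) j` and EVERY predicate `Q`:
`gibbsK_K.real({Q(dist1(Ū^j(∂p)))} ∩ {∀ i ∈ R, PlaqSmall θ_i (Ū^i)}) = gibbsK_K.real({Q(dist1(Ū^j(∂q)))} ∩ {…})`. [cite: Balaban1985UV3, (7) p.257] -/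
theorem gibbsK_real_setOf_inter_histBelow_eq (hγ : 0 ≤ γ) (K : ℕ) {j : ℕ} (θ : ℕ → ℝ) (R : ℕ → Prop) (hR : ∀ i, R i → i ≤ j)
    (p q : Plaq (F.P K) j) (Q : ℝ → Prop) :
    (gibbsK F ℰ γ K).real
        ({U | Q (dist1 (GaugeField.plaqHol (Averaging.iter (fun i' => BlockAveraging.blockAvg (P := F.P K) (j := i') ℰ) j U) p))} ∩
          {U | ∀ i, R i → PlaqSmall (θ i) (Averaging.iter (fun i' => BlockAveraging.blockAvg (P := F.P K) (j := i') ℰ) i U)}) =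
      (gibbsK F ℰ γ K).real
        ({U | Q (dist1 (GaugeField.plaqHol (Averaging.iter (fun i' => BlockAveraging.blockAvg (P := F.P K) (j := i') ℰ) j U) q))} ∩
          {U | ∀ i, R i → PlaqSmall (θ i) (Averaging.iter (fun i' => BlockAveraging.blockAvg (P := F.P K) (j := i') ℰ) i U)}) := by
  rw [Set.inter_comm, Set.inter_comm {U | Q (dist1 (GaugeField.plaqHol (Averaging.iter (fun i' =>
    BlockAveraging.blockAvg (P := F.P K) (j := i') ℰ) j U) q))}]
  exact gibbsMeasure_real_inter_setOf_dist1_iterPlaq_eq (F.scheme_β_nonneg ℰ hγ K) ℰ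
    (fun π U => by simpa only [Set.mem_setOf_eq] using histBelow_permute_iff ℰ θ R π U)
    (fun b U => by simpa only [Set.mem_setOf_eq] using histBelow_translate_iff ℰ θ R hR b U) p q Q

/-- **THE LETTERS' EVENT** (`hP` of ✓`UnitScaleTiltHistoryTailOfPinnedHeightTail.historyTailL_of_pinnedHeightTail`, `hG`, K-20's `hW`), SU(2),
`ℰ := ℰp`, written token for token: for `0 ≤ γ`, every `K j b₀ p₀` and any two plaquettes `p q : Plaq (F.P K) j`, the Gibbs masses of
`{θBal(K−j) ≤ dist1(Ū^j(∂·))} ∩ {∀ i < j, PlaqSmall θBal(K−i) (Ū^i)}` at `p` and at `q` are EQUAL. [cite: Balaban1985UV3, (7) p.257 and (71) p.273] -/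
theorem gibbsK_real_pinnedCond_eq (F : T3Family) {γ : ℝ} (hγ : 0 ≤ γ) (K j : ℕ) (b₀ p₀ : ℝ) (p q : Plaq (F.P K) j) :
    (gibbsK F ℰp γ K).real
        ({U : GaugeField (F.P K) 0 (Matrix.specialUnitaryGroup (Fin 2) ℂ) |
            θBal F.L γ b₀ p₀ (K - j) ≤ GaugeGroup.dist1 (GaugeField.plaqHol
              (Averaging.iter (fun i' => BlockAveraging.blockAvg (P := F.P K) (j := i') ℰp) j U) p)} ∩
          {U : GaugeField (F.P K) 0 (Matrix.specialUnitaryGroup (Fin 2) ℂ) | ∀ i, i < j →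
            PlaqSmall (θBal F.L γ b₀ p₀ (K - i))
              (Averaging.iter (fun i' => BlockAveraging.blockAvg (P := F.P K) (j := i') ℰp) i U)}) =
      (gibbsK F ℰp γ K).real
        ({U : GaugeField (F.P K) 0 (Matrix.specialUnitaryGroup (Fin 2) ℂ) |
            θBal F.L γ b₀ p₀ (K - j) ≤ GaugeGroup.dist1 (GaugeField.plaqHol
              (Averaging.iter (fun i' => BlockAveraging.blockAvg (P := F.P K) (j := i') ℰp) j U) q)} ∩
          {U : GaugeField (F.P K) 0 (Matrix.specialUnitaryGroup (Fin 2) ℂ) | ∀ i, i < j →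
            PlaqSmall (θBal F.L γ b₀ p₀ (K - i))
              (Averaging.iter (fun i' => BlockAveraging.blockAvg (P := F.P K) (j := i') ℰp) i U)}) :=
  gibbsK_real_setOf_inter_histBelow_eq F ℰp hγ K (fun i => θBal F.L γ b₀ p₀ (K - i)) (fun i => i < j) (fun _ hi => hi.le) p q
    (fun s => θBal F.L γ b₀ p₀ (K - j) ≤ s)

/-- **REDUCTION (the letters' inner inequality): ONE reference plaquette `q` per height ⇒ every plaquette `a` of that height** — any bound `c`
(e.g. `C·β_{K−j}^A·exp(−c·pFun²)` of `hP`, `Cv·(L⁻⁴)^{K−j}` of `hG`) on the conditioned pinned mass at `q` holds at `a`. [cite: Balaban1985UV3, (71) p.273] -/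
theorem pinnedCondTail_le_of_ref (F : T3Family) {γ : ℝ} (hγ : 0 ≤ γ) (K j : ℕ) (b₀ p₀ : ℝ) (q : Plaq (F.P K) j) {c : ℝ}
    (h : (gibbsK F ℰp γ K).real
        ({U : GaugeField (F.P K) 0 (Matrix.specialUnitaryGroup (Fin 2) ℂ) |
            θBal F.L γ b₀ p₀ (K - j) ≤ GaugeGroup.dist1 (GaugeField.plaqHol
              (Averaging.iter (fun i' => BlockAveraging.blockAvg (P := F.P K) (j := i') ℰp) j U) q)} ∩
          {U : GaugeField (F.P K) 0 (Matrix.specialUnitaryGroup (Fin 2) ℂ) | ∀ i, i < j →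
            PlaqSmall (θBal F.L γ b₀ p₀ (K - i))
              (Averaging.iter (fun i' => BlockAveraging.blockAvg (P := F.P K) (j := i') ℰp) i U)}) ≤ c)
    (a : Plaq (F.P K) j) :
    (gibbsK F ℰp γ K).real
        ({U : GaugeField (F.P K) 0 (Matrix.specialUnitaryGroup (Fin 2) ℂ) |
            θBal F.L γ b₀ p₀ (K - j) ≤ GaugeGroup.dist1 (GaugeField.plaqHol
              (Averaging.iter (fun i' => BlockAveraging.blockAvg (P := F.P K) (j := i') ℰp) j U) a)} ∩
          {U : GaugeField (F.P K) 0 (Matrix.specialUnitaryGroup (Fin 2) ℂ) | ∀ i, i < j →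
            PlaqSmall (θBal F.L γ b₀ p₀ (K - i))
              (Averaging.iter (fun i' => BlockAveraging.blockAvg (P := F.P K) (j := i') ℰp) i U)}) ≤ c := by
  rw [gibbsK_real_pinnedCond_eq F hγ K j b₀ p₀ a q]
  exact h

end T3

end Summit.QuantumFields.YangMills.Theorems.UnitScaleGibbsAveragedPlaquetteLawSymmetryCond

end
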